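/-
Origin: expansion seat `planner-pub-hodgecm-mc-sanity-1-g13-0`, handover #SAN30 2026-08-20T17:21Z md5 f3d69048d884 (SAN-30; NEW additive KERNEL census leaf, 182 l., 6 theorems + 1 Type-abbrev ∕ 0 Prop-defs in ns HodgeCM.Model.Sanity — the degenerate census of the SCOPE-guarded E of record (RUN 56): `CdegSOGS` (E's `C` group at `S := degS`, `W := zeroSK ∘ W`, any `hb`, RUN-56 shape verbatim), `perL_r21AEOGI_degS_scope` (E over degenerate data closes PerL modulo its own `C`, unwrapped; the seven Prop rows discharged at every context, guards ignored), `exists_goodSexticO_scope_at` ∕ `exists_anisotropic_goodSexticO_canonical_scope` (anisotropic good sextic context IN PerL's scope at a prescribed ∕ canonical ι₁, every `hb`, all data), `isEmpty_CdegSOGS` ∕ `isEmpty_CdegSOGS_orientBitι` (the scope-guarded `C` is EMPTY), `isEmpty_CdegSOG_of_scope` (SAN-28's emptiness back by forgetting); imports Sanity.DegenerateClosureOGEmpty only; no rowdep in RUN 57; drop-alone; rc 0 ∕ 0 warn ∕ 0 proof-hole ∕ axioms trio 6 ∕ 6; NAME LIST: HodgeCM.Model.Sanity.perL_r21AEOGI_degS_scope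 · HodgeCM.Model.Sanity.isEmpty_CdegSOGS_orientBitι · HodgeCM.Model.Sanity.exists_anisotropic_goodSexticO_canonical_scope) (`HOME/mc/pub-hodgecm-mc-sanity-1-g13/next13/HodgeCM/Model/Sanity/DegenerateClosureOGScope.lean`, md5 f3d69048d884, 182 lines);
landed by the gen-23 packager (p-g23) in gate run 57 as `HodgeCM/Model/Sanity/DegenerateClosureOGScope.lean` (verbatim).
-/
/-
HodgeCM / MODEL-CONSTRUCTION sub-cell (pub-hodgecm), SANITY lane (unit `pub-hodgecm-mc-sanity-1-g13`, node SAN-30).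
NEW additive KERNEL leaf `HodgeCM/Model/Sanity/DegenerateClosureOGScope.lean`; imports `HodgeCM.Model.Sanity.DegenerateClosureOGEmpty`
(SAN-28) only; nothing imports it; 0 records, 0 `def … : Prop`, 0 hypotheses records, no proof holes (one `abbrev` of a TYPE, as SAN-25/27); MODEL-N ±0.
-/
import Summits.HodgeConjecture.HodgeCM.Model.Sanity.DegenerateClosureOGEmpty

/-!
# SAN-30 — the degenerate census of E RE-DERIVED LITERALLY for the SCOPE-guarded E (RUN 56, lead (μ4))

Since RUN 56 the eight context rows of the E term of record `Model.perL_picardCM_r21AEOGI` carry PerL's SCOPE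
`Module.finrank ℚ c.K = 6 ∧ IsNormalClosure ℚ c.K L ∧ (Module.finrank ℚ L = 24 ∨ Module.finrank ℚ L = 48)` in place of
the bare rank premise `Module.finrank ℚ c.K = 6` (rank-first (D1); glue-1 #SG1–#SG45).  SAN-27/28 kept their statements
(SAN-27 now feeds E's `C` slot through `<SCOPE>.1`).  This leaf states the census about the re-assembled E in ITS OWN binder
shape:

* `CdegSOGS` — the SCOPE-guarded oriented data binder type (E's group `C` at `S := degS`, `W := zeroSK ∘ W`, any bit
  family `hb`), verbatim the shape of E's `C` since RUN 56 (SAN-27's rank-guarded `CdegSOG` maps INTO it: the scope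
  premise is stronger, so the binder is weaker — `isEmpty_CdegSOG_of_scope`);
* `perL_r21AEOGI_degS_scope (C : CdegSOGS …) : PerL` — the re-assembled E over the degenerate data `S := degS`,
  `W := zeroSK ∘ W` closes PerL modulo ITS OWN group `C`, handed over unwrapped: every other binder is discharged at every
  context, scope or no scope (SAN-22/25/27 discharges, guards ignored);
* `exists_goodSexticO_scope_at`, `exists_anisotropic_goodSexticO_canonical_scope` — an ANISOTROPIC good sextic context
  IN PERL'S SCOPE (`c.K := K` sextic, `L` := a normal closure of `K` of degree 24 or 48 — PerL's own hypothesis class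
  `perLHypothesesInhabited`) at a CANONICAL `ι₁`, for every bit family and all data (SAN-28's engine with the
  normal-closure conjunct KEPT instead of discarded);
* `isEmpty_CdegSOGS`, `isEmpty_CdegSOGS_orientBitι` — hence the scope-guarded `C` is EMPTY too: the scope guard does
  not rescue a degenerate closing of E; `isEmpty_CdegSOG_of_scope` — SAN-28's `isEmpty_CdegSOG` back, by forgetting.

READING (census): for the RUN-56 E exactly as for the RUN-41…55 E — over `S := degS` all binders but `C` hold at every
context and `C` is uninhabited; E is not closed by degenerate data, and the (μ4) scope guard changes neither half.
-/

set_option autoImplicit false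

noncomputable section

namespace HodgeCM
namespace Model
namespace Sanity

open HodgeCM.Universe (SideData ThetaModel AdelicThetaCore AdelicTorusCore)
open HodgeCM.PerL34 HodgeCM.PerL34.ArchC
open Literature.AlgebraicGeometry.HodgeTheory Literature.NumberTheory.Automorphic.PicardCM
open Literature.NumberTheory.Transcendental (Arapura2012_Cor_15_4_6)
open Literature.AlgebraicGeometry.ShimuraVarieties
open Literature.AlgebraicGeometry.Motives (CMType)
open HodgeCM.Model.ThetaSpace
open HodgeCM.Model.SupplyResidual

variable (hHD : exists_isReal_hodgeModel) (hI : hodgePQ_independent_of_hodgeModel)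
  (h₁ : BallQuotientUniformised)

/-- The SCOPE-guarded oriented data binder `C` of the E term of record (RUN 56 on) read at `S := degS`,
`W := zeroSK ∘ W`, for an arbitrary bit family `hb` — SAN-27's `CdegSOG` with PerL's scope conjunction in place of the
rank premise (verbatim shape of `Model.perL_picardCM_r21AEOGI`'s group `C`). -/
abbrev CdegSOGS (h₃ : CMAbelianVarietyRealised) (hb : ∀ L : CMField, (L →+* ℂ) → Bool) (hA : Arapura2012_Cor_15_4_6)
    (W : ∀ {L : CMField} {ι₁ : L →+* ℂ} (V : HermSpace3 L ι₁) (c : SeesawCtx L), WmInput V c.D)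
    (μ : ∀ {L : CMField}, SeesawCtx L → Fin 4 → NumberField.InfinitePlace L → ℤ) : Type 1 :=
  ∀ {L : CMField} {ι₁ : L →+* ℂ} (V : HermSpace3 L ι₁) (c : SeesawCtx L) (hV : IsAnisotropic L V.Hm),
    (thetaModelOf hHD hI h₁ h₃ (hb L ι₁) (embOf hHD hI h₁ h₃) (coverOf hHD hI h₁ h₃ hA)
      (wmOfInput fun V c => (W V c).zeroSK)
      (thetaOf _ (thetaClassInputOf _ (fun V c => thetaSpaceInputOf hHD hI h₁ h₃ degS V c))) (d12Of μ)
      (d34Of μ)).GoodCtx ι₁ c →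
    Module.finrank ℚ c.K = 6 ∧ IsNormalClosure ℚ c.K L ∧ (Module.finrank ℚ L = 24 ∨ Module.finrank ℚ L = 48) →
    (NumberField.InfinitePlace.mk ι₁).embedding = ι₁ →
      ∀ k : Fin 4, k = 0 ∨ k = 1 → ∀ N : ℕ, 0 < N →
        ArchKTypeData (thetaSpaceInputIn hHD hI h₁ h₃ (degS V c) hV) k N

/-- **The RUN-56 E term over the degenerate data closes PerL modulo ITS OWN (scope-guarded) group `C`**, handed over
unwrapped — the other seven Prop rows discharged at every context, guards ignored (SAN-22/25/27). -/
theorem perL_r21AEOGI_degS_scope (h₃' : CMAbelianVarietyEigenbasisRealised) (hA : Arapura2012_Cor_15_4_6)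
    (W : ∀ {L : CMField} {ι₁ : L →+* ℂ} (V : HermSpace3 L ι₁) (c : SeesawCtx L), WmInput V c.D)
    (μ : ∀ {L : CMField}, SeesawCtx L → Fin 4 → NumberField.InfinitePlace L → ℤ)
    (hR : DeligneMilne1982_Thm_6_20_full)
    (C : CdegSOGS hHD hI h₁ (cmAbelianVarietyRealised_of_eigenbasis hHD hI h₃') orientBitι hA W μ) :
    (picardCMUniverse hHD hI h₁ (cmAbelianVarietyRealised_of_eigenbasis hHD hI h₃')).PerL := by
  refine perL_picardCM_r21AEOGI hHD hI h₁ h₃' hA (fun V c => (W V c).zeroSK) degS μ hR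
    ?_ C ?_ ?_ ?_ ?_ ?_ ?_ ?_
  · -- `hΘ` at the bit of record, guards ignored — SAN-22
    intro L ι₁ V c _ _ _ i
    exact hTheta_degS hHD hI h₁ _ (orientBitι L ι₁) (embOf hHD hI h₁ _) (coverOf hHD hI h₁ _ hA)
      (wmOfInput fun V c => (W V c).zeroSK) (d12Of μ) (d34Of μ) V c i
  · -- `hT`
    intro L ι₁ V c k N
    exact isThetaArchContinuous_degS V c k N
  · -- `hpd` — vacuous over the empty `C`-fibre
    intro L ι₁ V c hV hc h6 hcan k hk N hN
    exact ((isEmpty_C_fibre_degS hHD hI h₁ _ V c hV).false (C V c hV hc h6 hcan)).elim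
  · -- `hk` (along form)
    intro L ι₁ V c hV hc h6 hcan k hk N hN p
    exact ((isEmpty_C_fibre_degS hHD hI h₁ _ V c hV).false (C V c hV hc h6 hcan)).elim
  · -- `gen12`, scope read through its rank component
    intro L ι₁ V c hc h6 _
    exact gen12_degS' hHD hI h₁ _ (orientBitι L ι₁) (embOf hHD hI h₁ _) (coverOf hHD hI h₁ _ hA)
      (fun V c => (W V c).zeroSK) μ V c hc h6.1
  · -- `real34`, guards ignored
    intro L ι₁ V c _ _ _
    exact real34_zeroSK (embOf hHD hI h₁ _) (coverOf hHD hI h₁ _ hA) W _ (orientBitι L ι₁) (d12Of μ)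
      (d34Of μ) V c
  · -- `hyp12`, guards ignored
    intro L ι₁ V c _ _ _
    exact hyp12_zeroSK (embOf hHD hI h₁ _) (coverOf hHD hI h₁ _ hA) W _ (orientBitι L ι₁) _ _ _ V c
  · -- `hyp34`, guards ignored
    intro L ι₁ V c _ _ _
    exact hyp34_zeroSK (embOf hHD hI h₁ _) (coverOf hHD hI h₁ _ hA) W _ (orientBitι L ι₁) _ _ _ V c

variable (h₃ : CMAbelianVarietyRealised)

/-- **An anisotropic good sextic context IN PERL'S SCOPE at a prescribed universe point** — SAN-28's engine
`exists_goodSexticO_at` with the normal-closure hypothesis KEPT in the conclusion (`c := ⟨K, t, φ 0, D⟩`, `c.K := K`). -/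
theorem exists_goodSexticO_scope_at (hb : ∀ L : CMField, (L →+* ℂ) → Bool) (emb) (cover) (wm) (Theta)
    (d12 d34 : ∀ {L : CMField}, SeesawCtx L → SideData L)
    {K L : CMField} (hN : IsNormalClosure ℚ K L) (hK : Module.finrank ℚ K = 6)
    (hL : Module.finrank ℚ L = 24 ∨ Module.finrank ℚ L = 48)
    (φ : Fin 3 → (K →+* ℂ)) (hφ : IsFrame φ) (t : Fin 4 → CMType K) (ht : IsPerLTypes φ t)
    (j : K →+* L) (ι₁ : L →+* ℂ) (hι₁ : ι₁.comp j = φ 0) :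
    ∃ (V : HermSpace3 L ι₁) (c : SeesawCtx L),
      IsAnisotropic L V.Hm ∧ (thetaModelOf hHD hI h₁ h₃ (hb L ι₁) emb cover wm Theta d12 d34).GoodCtx ι₁ c ∧
        (Module.finrank ℚ c.K = 6 ∧ IsNormalClosure ℚ c.K L ∧
          (Module.finrank ℚ L = 24 ∨ Module.finrank ℚ L = 48)) := by
  have hκ := (thetaModelOf hHD hI h₁ h₃ (hb L ι₁) emb cover wm Theta d12 d34).design_kappaConj_of_eq (hb L ι₁) rfl
  have hs := (thetaModelOf hHD hI h₁ h₃ (hb L ι₁) emb cover wm Theta d12 d34).design_frameSignConj_of_eq rfl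
  have hΨ : PairSum t := StubTree.pairSum_of_isPerLTypes K φ hφ hK t ht
  obtain ⟨D, hD⟩ :=
    (thetaModelOf hHD hI h₁ h₃ (hb L ι₁) emb cover wm Theta d12 d34).exists_seesawDatum_constructed hκ hs j ι₁ t hΨ
  obtain ⟨V⟩ := StubTree.landherr_exists L ι₁
  have h4 : 4 ≤ Module.finrank ℚ L := by rcases hL with hL | hL <;> omega
  exact ⟨V, ⟨K, t, φ 0, D⟩, V.isAnisotropic h4,
    ⟨hΨ, StubTree.injective_of_isPerLTypes K φ hφ t ht, fun i => (ht i 0).mpr (by fin_cases i <;> rfl),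
      ⟨j, hι₁, hD⟩⟩, hK, hN, hL⟩

/-- **An anisotropic good sextic context IN PERL'S SCOPE at a CANONICAL embedding**, for EVERY bit family and ALL data:
PerL's hypothesis class `perLHypothesesInhabited` (sextic `K`, normal closure `L`, `[L:ℚ] ∈ {24, 48}`) at the canonical
representative of its `ι₁`, re-based along `j` or `complexConj ∘ j` (SAN-28 `exists_embedding_mk_comp_eq`). -/
theorem exists_anisotropic_goodSexticO_canonical_scope (hb : ∀ L : CMField, (L →+* ℂ) → Bool) (emb) (cover) (wm)
    (Theta) (d12 d34 : ∀ {L : CMField}, SeesawCtx L → SideData L) :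
    ∃ (L : CMField) (ι₁ : L →+* ℂ) (V : HermSpace3 L ι₁) (c : SeesawCtx L),
      IsAnisotropic L V.Hm ∧ (thetaModelOf hHD hI h₁ h₃ (hb L ι₁) emb cover wm Theta d12 d34).GoodCtx ι₁ c ∧
        (Module.finrank ℚ c.K = 6 ∧ IsNormalClosure ℚ c.K L ∧
          (Module.finrank ℚ L = 24 ∨ Module.finrank ℚ L = 48)) ∧
        (NumberField.InfinitePlace.mk ι₁).embedding = ι₁ := by
  obtain ⟨K, L, j₀, hN, hK, hL, φ, hφ, ι₀, hι₀, t, ht⟩ := HodgeCM.perLHypothesesInhabited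
  obtain ⟨j, hj⟩ := exists_embedding_mk_comp_eq L j₀ ι₀
  obtain ⟨V, c, hV, hc, h6⟩ :=
    exists_goodSexticO_scope_at hHD hI h₁ h₃ hb emb cover wm Theta d12 d34 hN hK hL φ hφ t ht j _ (hj.trans hι₀)
  exact ⟨L, _, V, c, hV, hc, h6, by rw [NumberField.InfinitePlace.mk_embedding]⟩

/-- **`CdegSOGS` is EMPTY** for every bit family: the scope guard does not rescue a degenerate closing of E. -/
theorem isEmpty_CdegSOGS (hb : ∀ L : CMField, (L →+* ℂ) → Bool) (hA : Arapura2012_Cor_15_4_6)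
    (W : ∀ {L : CMField} {ι₁ : L →+* ℂ} (V : HermSpace3 L ι₁) (c : SeesawCtx L), WmInput V c.D)
    (μ : ∀ {L : CMField}, SeesawCtx L → Fin 4 → NumberField.InfinitePlace L → ℤ) :
    IsEmpty (CdegSOGS hHD hI h₁ h₃ hb hA W μ) := by
  refine ⟨fun C => ?_⟩
  obtain ⟨L, ι₁, V, c, hV, hc, h6, hcan⟩ :=
    exists_anisotropic_goodSexticO_canonical_scope hHD hI h₁ h₃ hb (embOf hHD hI h₁ h₃) (coverOf hHD hI h₁ h₃ hA)
      (wmOfInput fun V c => (W V c).zeroSK)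
      (thetaOf _ (thetaClassInputOf _ (fun V c => thetaSpaceInputOf hHD hI h₁ h₃ degS V c))) (d12Of μ) (d34Of μ)
  exact (isEmpty_C_fibre_degS hHD hI h₁ h₃ V c hV).false (C V c hV hc h6 hcan)

/-- **The data binder type of the RUN-56 E TERM OF RECORD over the degenerate data is EMPTY**: `CdegSOGS` at the bit of
record `orientBitι` — the hypothesis `C` of `perL_r21AEOGI_degS_scope` is uninhabited. -/
theorem isEmpty_CdegSOGS_orientBitι (hA : Arapura2012_Cor_15_4_6)
    (W : ∀ {L : CMField} {ι₁ : L →+* ℂ} (V : HermSpace3 L ι₁) (c : SeesawCtx L), WmInput V c.D)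
    (μ : ∀ {L : CMField}, SeesawCtx L → Fin 4 → NumberField.InfinitePlace L → ℤ) :
    IsEmpty (CdegSOGS hHD hI h₁ h₃ orientBitι hA W μ) :=
  isEmpty_CdegSOGS hHD hI h₁ h₃ orientBitι hA W μ

/-- Forgetting the scope: SAN-28 `isEmpty_CdegSOG` again, from the scope-guarded emptiness — SAN-27's rank-guarded
binder maps INTO the scope-guarded one by `fun V c hV hc h6 hcan => C V c hV hc h6.1 hcan` (the η-wrapper of glue-1's
#SG45 inside SAN-27; the scope premise is stronger, so the binder is weaker). -/
theorem isEmpty_CdegSOG_of_scope (hb : ∀ L : CMField, (L →+* ℂ) → Bool) (hA : Arapura2012_Cor_15_4_6)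
    (W : ∀ {L : CMField} {ι₁ : L →+* ℂ} (V : HermSpace3 L ι₁) (c : SeesawCtx L), WmInput V c.D)
    (μ : ∀ {L : CMField}, SeesawCtx L → Fin 4 → NumberField.InfinitePlace L → ℤ) :
    IsEmpty (CdegSOG hHD hI h₁ h₃ hb hA W μ) :=
  ⟨fun C => (isEmpty_CdegSOGS hHD hI h₁ h₃ hb hA W μ).false fun V c hV hc h6 hcan => C V c hV hc h6.1 hcan⟩

end Sanity
end Model
end HodgeCM

end
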